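/-
Copyright (c) 2026 the pub-hodgecm-mathlib formalisation cell (harness21).  Prover seat hodgecm-mathlib-K2E4-p23 (g2), Track B ∕ K2-LIT, h413 =
`stmt-HodgeConjecture-24833`, ENGINE E1, 5Res campaign «ENDGAME BY FAMILIES» (ROADCARD (154) of K2E1-plan (g7)), deal (171) P3a: the abstract Hilbert brick for C5b
(Plancherel isometry of the pseudo-Eisenstein family from its inner-product formula).
-/
import Mathlib.Analysis.InnerProductSpace.ProdL2
import Mathlib.Analysis.Normed.Operator.Extend
import Mathlib.LinearAlgebra.Finsupp.LinearCombination
import Mathlib.Topology.Algebra.Module.Basic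
import HarnessLib

/-!
# K2·E1 — `K2E1PlancherelIsometryOfForm`: A FAMILY WITH A HILBERT-SPACE MODEL OF ITS GRAM FORM SPANS AN ISOMETRIC COPY OF THE MODEL
# (ROADCARD «5Res ENDGAME BY FAMILIES» §2 C5b — the Plancherel isometry `Θ_χ ≅ R_χ ⊕ L²(ℝ_{>0})` from the inner-product formula T5a; Mathlib-only brick)

Track B ∕ K2-LIT, crux h413 = `stmt-HodgeConjecture-24833`, route of record `HCCMUnconditional`; cell `hodgecm-mathlib`, squad K2, ENGINE E1 (5Res campaign).  Prover seat
`hodgecm-mathlib-K2E4-p23` (g2); deal (171) of K2E1-plan (g7).  THEOREMS ONLY (no `def`, no `instance`, no notation, no named-fact hypothesis, no `sorry`); Mathlib-only; lane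
`--supports stmt-HodgeConjecture-24833 --as helper` (count-neutral).  CLOSES NO SOCKET.

THE BRICK.  `H`, `M` complex inner-product spaces, `M` complete; a family `x : ι → H` (E1: the pseudo-Eisenstein series `θ_f`, `f` ranging over test data) and MODEL vectors `u : ι → M`
(E1: `(residue components, Mellin transform on the unitary axis) ∈ ℂ^J ⊕ L²(ℝ_{>0})`, ★ T5a ED.2) with THE SAME GRAM FORM `hG : ⟪x i, x j⟫ = ⟪u i, u j⟫` for all `i, j`.  THEN on the
closed span `Sc := closure (span {x i})` there is a UNIQUE linear isometry `U : Sc →ₗᵢ[ℂ] M` with `U (x i) = u i`, and (for `H` complete) `range U = closure (span {u i})`.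
* §1 `inner_linearCombination_eq`, `norm_linearCombination_eq` — the Gram identity on finite linear combinations (so `Σ lᵢxᵢ = 0 ⇒ Σ lᵢuᵢ = 0` for free);
* §2 `denseRange_codRestrict_linearCombination` — finite combinations are dense in `Sc`;
* §3 **`exists_linearIsometry_of_inner_eq`**, **`linearIsometry_eq_of_apply_eq`** (uniqueness), **`range_linearIsometry_eq_topologicalClosure_span`** — built with Mathlib's
  extension-by-density `LinearMap.extendOfNorm` from the coefficient space `ι →₀ ℂ` (no quotient, no choice of basis);
* §4 **`exists_linearIsometry_of_inner_eq_add`** — the bookkeeping edition with model `M₁ ⊕₂ M₂` (`WithLp 2 (M₁ × M₂)`; E1: residues ⊕ continuous spectrum) from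
  `⟪x i, x j⟫ = ⟪r i, r j⟫ + ⟪c i, c j⟫`; `fst_snd_mem_topologicalClosure_span` — the coordinates of `range U` lie in the two coordinate closed spans (inclusions only).
HONEST LABEL: HC_CM is proved only modulo the 7 printed citations (2 remaining named inputs: hLiu418 = `stmt-HodgeConjecture-24832`, h413 = `stmt-HodgeConjecture-24833`) until rung 0
closes; this file asserts no named fact and closes no socket; count-neutral.

## References
* [MoeglinWaldspurger1995] C. Mœglin, J.-L. Waldspurger, *Spectral decomposition and Eisenstein series* (1995), II.2.1–II.2.4, VI.2 (pseudo-Eisenstein series and their inner products).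
* [ReedSimonI1980] M. Reed, B. Simon, *Methods of Modern Mathematical Physics I* (1980), Thm. I.7 (BLT: extension of a bounded operator from a dense subspace), §II.3.
-/

set_option autoImplicit false
-- the mandated namespace repeats the single-problem summit's segment (`HodgeConjecture.HodgeConjecture`)
set_option linter.dupNamespace false

noncomputable section

open Set Submodule
open scoped InnerProductSpace ComplexConjugate

namespace Summit.HodgeConjecture.HodgeConjecture.Cruxes.H413.K2E1PlancherelIsometryOfForm

variable {ι H M : Type*} [NormedAddCommGroup H] [InnerProductSpace ℂ H] [NormedAddCommGroup M] [InnerProductSpace ℂ M]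

/-! ## §1 The Gram identity on finite linear combinations -/

/-- **GRAM IDENTITY ON FINITE COMBINATIONS**: `⟪Σ lᵢxᵢ, Σ l′ⱼxⱼ⟫ = ⟪Σ lᵢuᵢ, Σ l′ⱼuⱼ⟫` from `⟪xᵢ, xⱼ⟫ = ⟪uᵢ, uⱼ⟫`. [cite: ReedSimonI1980, §II.3] -/
theorem inner_linearCombination_eq {x : ι → H} {u : ι → M} (hG : ∀ i j, ⟪x i, x j⟫_ℂ = ⟪u i, u j⟫_ℂ) (l l' : ι →₀ ℂ) :
    ⟪Finsupp.linearCombination ℂ x l, Finsupp.linearCombination ℂ x l'⟫_ℂ = ⟪Finsupp.linearCombination ℂ u l, Finsupp.linearCombination ℂ u l'⟫_ℂ := by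
  simp only [Finsupp.linearCombination_apply, Finsupp.sum_inner, Finsupp.inner_sum, inner_smul_left, inner_smul_right, hG]

/-- `‖Σ lᵢxᵢ‖ = ‖Σ lᵢuᵢ‖`. [cite: ReedSimonI1980, §II.3] -/
theorem norm_linearCombination_eq {x : ι → H} {u : ι → M} (hG : ∀ i j, ⟪x i, x j⟫_ℂ = ⟪u i, u j⟫_ℂ) (l : ι →₀ ℂ) :
    ‖Finsupp.linearCombination ℂ x l‖ = ‖Finsupp.linearCombination ℂ u l‖ := by
  rw [norm_eq_sqrt_re_inner (𝕜 := ℂ) (Finsupp.linearCombination ℂ x l), norm_eq_sqrt_re_inner (𝕜 := ℂ) (Finsupp.linearCombination ℂ u l),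
    inner_linearCombination_eq hG]

/-! ## §2 Finite combinations are dense in the closed span -/

/-- Finite linear combinations of the `x i` lie in the closed span. [folklore] -/
theorem linearCombination_mem_topologicalClosure (x : ι → H) (l : ι →₀ ℂ) :
    Finsupp.linearCombination ℂ x l ∈ (span ℂ (Set.range x)).topologicalClosure :=
  le_topologicalClosure _ (by rw [← Finsupp.range_linearCombination]; exact LinearMap.mem_range_self _ l)

/-- Each `x i` lies in the closed span. [folklore] -/
theorem mem_topologicalClosure_span (x : ι → H) (i : ι) : x i ∈ (span ℂ (Set.range x)).topologicalClosure :=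
  le_topologicalClosure _ (subset_span (Set.mem_range_self i))

/-- **FINITE COMBINATIONS ARE DENSE IN THE CLOSED SPAN** (as a map `(ι →₀ ℂ) → Sc`). [folklore] -/
theorem denseRange_codRestrict_linearCombination (x : ι → H) :
    DenseRange (LinearMap.codRestrict (span ℂ (Set.range x)).topologicalClosure (Finsupp.linearCombination ℂ x) (linearCombination_mem_topologicalClosure x)) := by
  intro v
  rw [closure_subtype, ← Set.range_comp]
  have hcomp : ((↑) : (span ℂ (Set.range x)).topologicalClosure → H) ∘
      (LinearMap.codRestrict (span ℂ (Set.range x)).topologicalClosure (Finsupp.linearCombination ℂ x) (linearCombination_mem_topologicalClosure x)) =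
      Finsupp.linearCombination ℂ x := rfl
  rw [hcomp, ← LinearMap.coe_range, Finsupp.range_linearCombination, ← topologicalClosure_coe]
  exact v.2

/-! ## §3 The isometry -/

variable [CompleteSpace M]

/-- **EXISTENCE: THE GRAM MODEL IS REALISED BY A LINEAR ISOMETRY ON THE CLOSED SPAN** — `∃ U : Sc →ₗᵢ[ℂ] M, U (x i) = u i` (Mathlib `LinearMap.extendOfNorm` from the coefficient space
along the dense map `l ↦ Σ lᵢxᵢ`, bound `‖Σ lᵢuᵢ‖ = ‖Σ lᵢxᵢ‖`; isometric on `Sc` by density).  Moreover `U (Σ lᵢxᵢ) = Σ lᵢuᵢ`. [cite: ReedSimonI1980, Thm. I.7] [cite: MoeglinWaldspurger1995, II.2.4] -/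
theorem exists_linearIsometry_of_inner_eq {x : ι → H} {u : ι → M} (hG : ∀ i j, ⟪x i, x j⟫_ℂ = ⟪u i, u j⟫_ℂ) :
    ∃ U : (span ℂ (Set.range x)).topologicalClosure →ₗᵢ[ℂ] M,
      (∀ l : ι →₀ ℂ, U ⟨Finsupp.linearCombination ℂ x l, linearCombination_mem_topologicalClosure x l⟩ = Finsupp.linearCombination ℂ u l) ∧
      ∀ i, U ⟨x i, mem_topologicalClosure_span x i⟩ = u i := by
  set e := LinearMap.codRestrict (span ℂ (Set.range x)).topologicalClosure (Finsupp.linearCombination ℂ x) (linearCombination_mem_topologicalClosure x) with he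
  have hd : DenseRange e := denseRange_codRestrict_linearCombination x
  have hnorm : ∀ l : ι →₀ ℂ, ‖Finsupp.linearCombination ℂ u l‖ ≤ 1 * ‖e l‖ := fun l => by
    rw [one_mul, ← norm_linearCombination_eq hG l]; rfl
  set Uc := (Finsupp.linearCombination ℂ u).extendOfNorm e with hUc
  have hUe : ∀ l, Uc (e l) = Finsupp.linearCombination ℂ u l := LinearMap.extendOfNorm_eq hd ⟨1, hnorm⟩
  have hiso : ∀ v, ‖Uc v‖ = ‖v‖ := fun v =>
    hd.induction_on v (isClosed_eq (continuous_norm.comp Uc.continuous) continuous_norm) fun l => by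
      rw [hUe, ← norm_linearCombination_eq hG l]; rfl
  refine ⟨{ toLinearMap := Uc.toLinearMap, norm_map' := hiso }, fun l => hUe l, fun i => ?_⟩
  have hxi : (⟨x i, mem_topologicalClosure_span x i⟩ : (span ℂ (Set.range x)).topologicalClosure) = e (Finsupp.single i 1) :=
    Subtype.ext (by rw [he, LinearMap.codRestrict_apply, Finsupp.linearCombination_single, one_smul])
  change Uc ⟨x i, mem_topologicalClosure_span x i⟩ = u i
  rw [hxi, hUe, Finsupp.linearCombination_single, one_smul]

omit [CompleteSpace M] in
/-- A linear isometry on the closed span with `U (x i) = u i` maps `Σ lᵢxᵢ ↦ Σ lᵢuᵢ`. [folklore] -/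
theorem linearIsometry_apply_linearCombination {x : ι → H} {u : ι → M} (U : (span ℂ (Set.range x)).topologicalClosure →ₗᵢ[ℂ] M)
    (hU : ∀ i, U ⟨x i, mem_topologicalClosure_span x i⟩ = u i) (l : ι →₀ ℂ) :
    U ⟨Finsupp.linearCombination ℂ x l, linearCombination_mem_topologicalClosure x l⟩ = Finsupp.linearCombination ℂ u l := by
  have hcomp : U.toLinearMap.comp (LinearMap.codRestrict (span ℂ (Set.range x)).topologicalClosure (Finsupp.linearCombination ℂ x)
      (linearCombination_mem_topologicalClosure x)) = Finsupp.linearCombination ℂ u := by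
    refine Finsupp.lhom_ext fun i c => ?_
    rw [LinearMap.comp_apply, Finsupp.linearCombination_single]
    have hsingle : LinearMap.codRestrict (span ℂ (Set.range x)).topologicalClosure (Finsupp.linearCombination ℂ x) (linearCombination_mem_topologicalClosure x)
        (Finsupp.single i c) = c • (⟨x i, mem_topologicalClosure_span x i⟩ : (span ℂ (Set.range x)).topologicalClosure) :=
      Subtype.ext (by rw [LinearMap.codRestrict_apply, Finsupp.linearCombination_single]; rfl)
    rw [hsingle, LinearIsometry.coe_toLinearMap, map_smul, hU]
  have h := LinearMap.congr_fun hcomp l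
  rw [LinearMap.comp_apply] at h
  exact h

omit [CompleteSpace M] in
/-- **UNIQUENESS**: two linear isometries on the closed span with `U (x i) = u i` coincide (they agree on the dense finite combinations). [cite: ReedSimonI1980, Thm. I.7] -/
theorem linearIsometry_eq_of_apply_eq {x : ι → H} {u : ι → M} (U U' : (span ℂ (Set.range x)).topologicalClosure →ₗᵢ[ℂ] M)
    (hU : ∀ i, U ⟨x i, mem_topologicalClosure_span x i⟩ = u i) (hU' : ∀ i, U' ⟨x i, mem_topologicalClosure_span x i⟩ = u i) : U = U' := by
  apply LinearIsometry.toContinuousLinearMap_injective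
  apply ContinuousLinearMap.coeFn_injective
  refine Continuous.ext_on (denseRange_codRestrict_linearCombination x) U.continuous U'.continuous fun v hv => ?_
  obtain ⟨l, rfl⟩ := hv
  change U ⟨Finsupp.linearCombination ℂ x l, linearCombination_mem_topologicalClosure x l⟩ =
    U' ⟨Finsupp.linearCombination ℂ x l, linearCombination_mem_topologicalClosure x l⟩
  exact (linearIsometry_apply_linearCombination U hU l).trans (linearIsometry_apply_linearCombination U' hU' l).symm

omit [CompleteSpace M] in
/-- **THE RANGE IS THE CLOSED SPAN OF THE MODEL VECTORS** (`H` complete): `range U = closure (span {u i})` — the image of a complete space under an isometry is closed and contains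
the `u i`; conversely `U(Sc) ⊆ closure U(span) = closure span {u i}`. [cite: ReedSimonI1980, Thm. I.7] [cite: MoeglinWaldspurger1995, II.2.4] -/
theorem range_linearIsometry_eq_topologicalClosure_span [CompleteSpace H] {x : ι → H} {u : ι → M} (U : (span ℂ (Set.range x)).topologicalClosure →ₗᵢ[ℂ] M)
    (hU : ∀ i, U ⟨x i, mem_topologicalClosure_span x i⟩ = u i) :
    Set.range U = ((span ℂ (Set.range u)).topologicalClosure : Set M) := by
  haveI : CompleteSpace (span ℂ (Set.range x)).topologicalClosure := (isClosed_topologicalClosure _).completeSpace_coe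
  apply Set.Subset.antisymm
  · -- `range U ⊆ closure (U '' (finite combinations)) = closure (span u)`
    have hd := denseRange_codRestrict_linearCombination x
    have h1 : Set.range U = U '' closure (Set.range (LinearMap.codRestrict (span ℂ (Set.range x)).topologicalClosure (Finsupp.linearCombination ℂ x)
        (linearCombination_mem_topologicalClosure x))) := by
      rw [hd.closure_range, Set.image_univ]
    rw [h1, topologicalClosure_coe]
    refine (image_closure_subset_closure_image U.continuous).trans (closure_mono ?_)
    rintro _ ⟨_, ⟨l, rfl⟩, rfl⟩
    change U ⟨Finsupp.linearCombination ℂ x l, linearCombination_mem_topologicalClosure x l⟩ ∈ ((span ℂ (Set.range u) : Submodule ℂ M) : Set M)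
    rw [linearIsometry_apply_linearCombination U hU l, ← Finsupp.range_linearCombination]
    exact LinearMap.mem_range_self _ l
  · -- `closure (span u) ⊆ range U` since `range U` is closed and contains the `u i`
    have hclosed : IsClosed (Set.range U) := U.isometry.isUniformInducing.isComplete_range.isClosed
    rw [topologicalClosure_coe]
    refine closure_minimal ?_ hclosed
    change ((span ℂ (Set.range u) : Submodule ℂ M) : Set M) ⊆ (LinearMap.range U.toLinearMap : Set M)
    rw [SetLike.coe_subset_coe]
    refine span_le.2 ?_
    rintro _ ⟨i, rfl⟩
    exact ⟨⟨x i, mem_topologicalClosure_span x i⟩, hU i⟩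

/-! ## §4 Bookkeeping: model `M₁ ⊕₂ M₂` (residues ⊕ continuous spectrum) -/

/-- **THE `⊕`-EDITION**: if `⟪x i, x j⟫ = ⟪r i, r j⟫ + ⟪c i, c j⟫` with `r : ι → M₁`, `c : ι → M₂` (complete inner-product spaces; E1: `M₁ = ℂ^J` the residues, `M₂ = L²(ℝ_{>0})` the Mellin
side, ★ T5a ED.2), then there is a linear isometry `U : Sc →ₗᵢ[ℂ] M₁ ⊕₂ M₂` (`WithLp 2 (M₁ × M₂)`) with `U (x i) = (r i, c i)`, unique by §3, onto `closure span {(r i, c i)}` when `H` is complete.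
[cite: MoeglinWaldspurger1995, II.2.4, VI.2] -/
theorem exists_linearIsometry_of_inner_eq_add {M₁ M₂ : Type*} [NormedAddCommGroup M₁] [InnerProductSpace ℂ M₁] [CompleteSpace M₁]
    [NormedAddCommGroup M₂] [InnerProductSpace ℂ M₂] [CompleteSpace M₂] {x : ι → H} (r : ι → M₁) (c : ι → M₂)
    (hG : ∀ i j, ⟪x i, x j⟫_ℂ = ⟪r i, r j⟫_ℂ + ⟪c i, c j⟫_ℂ) :
    ∃ U : (span ℂ (Set.range x)).topologicalClosure →ₗᵢ[ℂ] WithLp 2 (M₁ × M₂), ∀ i, U ⟨x i, mem_topologicalClosure_span x i⟩ = WithLp.toLp 2 (r i, c i) := by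
  have hG' : ∀ i j, ⟪x i, x j⟫_ℂ = ⟪WithLp.toLp 2 (r i, c i), WithLp.toLp 2 (r j, c j)⟫_ℂ := fun i j => by
    rw [WithLp.prod_inner_apply, hG]
  obtain ⟨U, -, hU⟩ := exists_linearIsometry_of_inner_eq hG'
  exact ⟨U, hU⟩

/-- **`⊕`-BOOKKEEPING — COORDINATES OF THE RANGE** (`H` complete): for an isometry `U : Sc →ₗᵢ M₁ ⊕₂ M₂` with `U (x i) = (r i, c i)`, every `U v` has its first coordinate in
`closure span {r i}` and its second in `closure span {c i}` (E1: residue part in the span of the residues, continuous part in the closed span of the Mellin transforms).  Only the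
inclusions hold — `range U` is the closed span of the PAIRS, in general a proper subspace of the product of the two closures. [cite: MoeglinWaldspurger1995, II.2.4, VI.2] -/
theorem fst_snd_mem_topologicalClosure_span [CompleteSpace H] {M₁ M₂ : Type*} [NormedAddCommGroup M₁] [InnerProductSpace ℂ M₁] [CompleteSpace M₁]
    [NormedAddCommGroup M₂] [InnerProductSpace ℂ M₂] [CompleteSpace M₂] {x : ι → H} {r : ι → M₁} {c : ι → M₂}
    (U : (span ℂ (Set.range x)).topologicalClosure →ₗᵢ[ℂ] WithLp 2 (M₁ × M₂)) (hU : ∀ i, U ⟨x i, mem_topologicalClosure_span x i⟩ = WithLp.toLp 2 (r i, c i))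
    (v : (span ℂ (Set.range x)).topologicalClosure) :
    (WithLp.ofLp (U v)).1 ∈ (span ℂ (Set.range r)).topologicalClosure ∧ (WithLp.ofLp (U v)).2 ∈ (span ℂ (Set.range c)).topologicalClosure := by
  -- the closed submodule `T = {m | m.1 ∈ closure span r ∧ m.2 ∈ closure span c}` contains every `(r i, c i)`, hence `closure span {(r i, c i)} = range U`
  set T : Submodule ℂ (WithLp 2 (M₁ × M₂)) :=
    (((span ℂ (Set.range r)).topologicalClosure).prod (span ℂ (Set.range c)).topologicalClosure).comap (WithLp.linearEquiv 2 ℂ (M₁ × M₂)).toLinearMap with hT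
  have hTc : IsClosed (T : Set (WithLp 2 (M₁ × M₂))) :=
    ((isClosed_topologicalClosure _).prod (isClosed_topologicalClosure _)).preimage (WithLp.prod_continuous_ofLp 2 M₁ M₂)
  have hr : U v ∈ ((span ℂ (Set.range fun i => WithLp.toLp 2 (r i, c i))).topologicalClosure : Set (WithLp 2 (M₁ × M₂))) := by
    rw [← range_linearIsometry_eq_topologicalClosure_span U hU]; exact Set.mem_range_self v
  rw [topologicalClosure_coe] at hr
  have hsub : ((span ℂ (Set.range fun i => WithLp.toLp 2 (r i, c i)) : Submodule ℂ (WithLp 2 (M₁ × M₂))) : Set (WithLp 2 (M₁ × M₂))) ⊆ T := by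
    rw [SetLike.coe_subset_coe]
    refine span_le.2 ?_
    rintro _ ⟨i, rfl⟩
    exact Submodule.mem_comap.2 (Submodule.mem_prod.2
      ⟨le_topologicalClosure _ (subset_span (Set.mem_range_self i)), le_topologicalClosure _ (subset_span (Set.mem_range_self i))⟩)
  have hmem : U v ∈ T := closure_minimal hsub hTc hr
  exact Submodule.mem_prod.1 (Submodule.mem_comap.1 hmem)

end Summit.HodgeConjecture.HodgeConjecture.Cruxes.H413.K2E1PlancherelIsometryOfForm

end
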